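import Literature.MathematicalPhysics.QuantumFieldTheory.Balaban1983to89.B1
import Literature.MathematicalPhysics.QuantumFieldTheory.Balaban1983to89.B4TwoRegion120

/-!
# `Balaban1983to89.B1Prop22Proof` — T. Bałaban, *(Higgs)₂,₃ quantum fields in a finite volume. I. A lower bound*,
# Commun. Math. Phys. **85** (1982) 603–626 [Balaban1982Higgs1]: **Proposition 2.2** (2.27)–(2.29) p. 611 — the decay
# of the kernel of `Δ^{(k)}(Ω,A) = a_kI − a_k²Q_k(A)G_k(Ω,A)Q_k^*(A)` and of `δΔ^{(k)}(Ω,Ω₀,A)` — (§1) PROVED WITH NO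
# HYPOTHESIS at the MODEL INSTANCE `A = 0` (decl of record `…B1.Prop22Literal`, every mesh, every window of `a_k`,
# every mass, EVERY nested pair of finite regions) from the B4 cell's zero-field theorems, and (§2) DERIVED AS PRINTED
# in B4 p. 593–594 (*"Finally Corollary 2.3 implies … (5.4) … (5.5)"*) from `…B4.Cor23Printed` for every dictionary
# instance (`…B1.Prop22Small`, the intended reading with the inherited smallness threshold)

statement-level skeleton of published theorems with citation tags; proofs where landed; nothing here is a claim about the Yang–Mills mass gap

PDF held: `paper:balaban1982-cmp85-higgs23-i` (journal page = PDF page + 602), p. 611 read as an image on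
`run/shared/lean/pub/pub-balaban/b2b-balaban-ref1/pages/1982-cmp85-higgs23-I/1982-cmp85-higgs23-I-p009-x2.png`; B4 =
[Balaban1983RegularityDecay] pp. 573, 580–581, 593–594 on `…/1983-cmp89-regularity-decay/…-p003, p010, p011, p023,
p024-x2.png` (journal page = PDF page + 570).

CITATION HEADER (lean-in-tree rule).  Cell `lit-balaban` (HOME `run/shared/lean/pub/lit-balaban/`), Phase-2 proof seat
**p17** gen 2 (unit `lit-balaban-p17-g2`); SKELETON row **B1.Prop2.2** (decls of record `…B1.Prop22Literal` /
`…B1.Prop22Small` over the carrier `…B1.DeltaSetting`, cell pub-balaban pv07 — UNCHANGED); kind «model instance +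
knitting» (PHASE2-TARGETS §G.1); fold owners r01/r14, referee ref-4.  USED BY NAME, never restated (the B4 sub-cell's
zero-field lineage, pub-balaban b04/pv-seats; files untouched): `…B4Prop31Zero.KeffR` (`Δ^{(k)}(Ω,0)` as a matrix on the
unit sites, (1.14) at `A = 0`), `…B4RegionCov1518.KeffR_entry_decay` (= B4 (5.4) at `A = 0`) with the window rate
`ctRate` / `ctRate_small`, `…B4TwoRegion120.keff55_region` (= B4 (5.5) at `A = 0`, hypothesis-free), `dSet`, `incl`;
`…B4.Cor23Printed` / `EtaSetting` (b04) for §2.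

WHAT IS PRINTED (verbatim, I p. 611 [PDF 9]): *"We will formulate some consequences of the above theorem. The first
concerns the operator Δ^{(k),L^kε}(Ω, A) rescaled to the unit lattice, i.e. the operator Δ^{(k)}(Ω, A).  **Proposition
2.2.** If a configuration A is regular in the same sense as in Proposition 2.1 then there exist constants δ₀ > 0 and c₀,
depending on the same quantities as in Proposition 2.1, such that |Δ^{(k)}(Ω, A; x, x′)| ≦ c₀exp(−δ₀|x − x′|), x, x′ ∈
Ω^{(k)}.  (2.27)  Putting for Ω ⊂ Ω₀ δΔ^{(k)}(Ω, Ω₀, A) = Δ^{(k)}(Ω, A) − Δ^{(k)}(Ω₀, A),  (2.28)  the following inequality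
holds |δΔ^{(k)}(Ω, Ω₀, A; x, x′)| ≦ c₀ exp(−δ₀(|x − x′| + dist(x, Ω^{(k)c}) + dist(x′, Ω^{(k)c}))).  (2.29)"*  No proof in
I; B4 p. 593–594 [PDF 23–24]: *"Finally Corollary 2.3 implies that the considered operator is short-ranged in the sense
that for some δ₀ > 0  |(Δ^{(k)}(Ω, A) + aL^{−2}P(A))(x, x′)| ≦ c₀e^{−δ₀|x−x′|}, x, x′ ∈ Ω^{(k)},  (5.4)  and a change of the
domain Ω implies a change of the operator which can be estimated in the following way |(Δ^{(k)}(Ω, A) − Δ^{(k)}(Ω₀, A))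
(x, x′)| ≦ c₀e^{−δ₀(|x−x′|+dist(x, Ω^{(k)c})+dist(x′, Ω^{(k)c}))}, Ω ⊂ Ω₀, x, x′ ∈ Ω^{(k)}.  (5.5)"*; B4 Cor. 2.3 (2.30)
p. 580–581: *"|⟨f, G_k(Ω,A)f′⟩| […] ≦ c₀e^{−δ₀dist(supp f, supp f′)}‖f‖₂‖f′‖₂. (2.30)  The same inequalities hold for
δG_k(Ω,Ω₀,A) with the additional factor e^{−δ₀(dist(supp f,Ωᶜ) + dist(supp f′,Ωᶜ))}."*  The dictionary (I (2.11), (2.20)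
weight-1 adjoint, (1.14)): `Δ^{(k)}(Ω,A;y,y′) = a_kδ_{yy′} − a_k²⟨Q_k^*(A)δ_y, G_k(Ω,A)Q_k^*(A)δ_{y′}⟩`, the sources
`Q_k^*(A)(vδ_y)` having `‖·‖₂ = |v|` (η-weighted ℓ²; unitary transports) and supports `B^k(y)`, whence
`dist(supp, supp′) ≥ |y − y′| − D`, `dist(supp, Ωᶜ) ≥ dist(y, Ω^{(k)c}) − D` (`D` = a block-diameter allowance); the
diagonal `a_kδ_{yy′}` cancels in `δΔ^{(k)}`.

WHAT IS PROVED (kernel-checked, zero `sorry`, no new `def … : Prop`; axioms standard).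
* §1 (**`prop22Literal_zeroField`**, **`prop22Small_zeroField`**, NO hypothesis): on the family `zeroDelta` of ALL
  zero-field instances — mesh `η = 1/n` (`n ≥ 1`; in print `n = L^k`), `a_k ∈ [a₋, a₊]` (`a₋ > 0`; I (2.15): `a(1 −
  L^{−2}) < a_k ≦ a`), `m² ≥ 0`, ANY nested pair `Ω^{(k)} ⊆ Ω₀^{(k)}` of finite sets of unit sites (fine regions = the
  unions of their blocks, Neumann conditions), charge `e` inert — with `kerD y y′ = |Δ^{(k)}(Ω,0)(y,y′)|` (`KeffR`),
  `kerDD0 y y′ = |Δ^{(k)}(Ω,0)(y,y′) − Δ^{(k)}(Ω₀,0)(y,y′)|`, `udist = |y − y′|_∞`, `dist(y, Ω^{(k)c})` READ AS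
  `dist_∞(y, Ω₀^{(k)} ∖ Ω^{(k)})` (the B4 cell's reading of the complement inside the ambient region, `dSet`; `= 0` when
  `Ω₀ = Ω`), `regular := True`, `bigBlocks := True` (no big-block hypothesis is needed at `A = 0`): the typed
  `B1.Prop22Literal` holds with `δ₀ = ctRate(d,a₋,a₊)/4` and an explicit `c₀`; (2.27) ⇐ `KeffR_entry_decay`, (2.29) ⇐
  `keff55_region`.
* §2 (**`prop22Small_of_cor23Printed`**): for every family of dictionary instances `DictΔ D aM` — a B4/I-Prop-2.1
  instance `S : B4.EtaSetting`, unit sites `y`, nonempty test vectors, sources `f_{y,v} = Q_k^*(A)(vδ_y)` with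
  `0 ≤ ‖f‖₂ ≤ 1`, coefficients `0 ≤ a₁, a₂ ≤ aM` (`a_k`, `a_k²`), the kernel dominations `|Δ^{(k)}(y,y′)| ≤ a₁·1_{y=y′} +
  a₂·sup|⟨f_y, Gf_{y′}⟩|`, `|δΔ^{(k)}(y,y′)| ≤ a₂·sup|⟨f_y, δGf_{y′}⟩|`, and the geometry `|y−y′| ≤ dist(supp f_y, supp
  f_{y′}) + D`, `dist(y,Ω^{(k)c}) ≤ dist(supp f_y, Ωᶜ) + D` — `B4.Cor23Printed` for the `S`-family implies
  `B1.Prop22Small` for the linked `DeltaSetting` family (same `δ₀`, threshold `e₁`, `c₀ ↦ aM + aM·c₀·e^{3δ₀D}`).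
NOT CLAIMED: anything at `A ≠ 0` beyond the conditional §2 IN THIS FILE; the literal threshold-free `Prop22Literal` from
Cor. 2.3 (Cor. 2.3 carries the threshold; only `Prop22Small` follows, as the carrier's docstring anticipates).

v1.1 (DOCFIX, same seat): the v1 parenthesis «B4's Cor. 2.3 at `A ≠ 0` is not in the tree» was WRONG — b04's
`B4Cor23RegionEta.cor23Printed_regularPair` IS Cor. 2.3 typed at `A ≠ 0` on the regular-field region pairs; §2 is fed with it
in the companion `B1Prop22RegularField` (`prop22Small_regularPair`: `B1.Prop22Small` AT `A ≠ 0`, every vector field regular in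
the sense (1.7)), whose algebra is `B1Prop22RegularFieldAlg`.  No Lean statement or proof changed.
-/

namespace Literature.MathematicalPhysics.QuantumFieldTheory.Balaban1983to89.B1Prop22Proof

open Literature.MathematicalPhysics.QuantumFieldTheory.Balaban1983to89
open Literature.MathematicalPhysics.QuantumFieldTheory.Balaban1983to89.B4ContourShift (supNorm supNorm_nonneg)
open Literature.MathematicalPhysics.QuantumFieldTheory.Balaban1983to89.B4Prop31Zero (KeffR)
open Literature.MathematicalPhysics.QuantumFieldTheory.Balaban1983to89.B4RegionCov1518 (KeffR_entry_decay ctRate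
  ctRate_pos ctRate_le_one ctRate_small)
open Literature.MathematicalPhysics.QuantumFieldTheory.Balaban1983to89.B4TwoRegion120 (incl dSet dSet_nonneg
  keff55_region)

noncomputable section

variable {d : ℕ}

/-! ## §1. The model instance `A = 0`: `B1.Prop22Literal` on every nested pair of finite regions, NO hypothesis -/

/-- ONE ZERO-FIELD INSTANCE of Prop. 2.2: mesh `η = 1/n`, the constant `a_k` (inside the window `[a₋, a₊]` of the
family), the mass `m² ≥ 0`, the nested unit-site regions `Ω^{(k)} ⊆ Ω₀^{(k)}` (finite subsets of `ℤ^{d+1}`), and the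
charge `e` of (2.23) (inert at `A = 0`). [cite: Balaban1982Higgs1, Prop. 2.2 (2.27)–(2.29) p.611] -/
structure ZFNested (d : ℕ) (amin aplus : ℝ) where
  /-- `η = 1/n` -/
  n : ℕ
  hn : 1 ≤ n
  /-- `a_k` -/
  a : ℝ
  ha₁ : amin ≤ a
  ha₂ : a ≤ aplus
  /-- `m²` -/
  m2 : ℝ
  hm : 0 ≤ m2
  /-- `Ω^{(k)} ⊆ Ω₀^{(k)}` -/
  Ω : Finset (Fin (d + 1) → ℤ)
  Ω₀ : Finset (Fin (d + 1) → ℤ)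
  hsub : Ω ⊆ Ω₀
  /-- the charge (inert) -/
  e : ℝ

/-- The carrier `B1.DeltaSetting` of a zero-field instance: `kerD y y′ = |Δ^{(k)}(Ω,0)(y,y′)|` with `Δ^{(k)}(Ω,0)` =
the B4 cell's `KeffR` (`a_kI − a_k²Q_kG_k(Ω,0)Q_k^*`, (1.14)/(2.21) at `A = 0`), `kerDD0 y y′ = |δΔ^{(k)}(Ω,Ω₀,0)(y,y′)|`
((2.28)), `udist = |y − y′|_∞`, `distOc y = dist_∞(y, Ω₀^{(k)} ∖ Ω^{(k)})` (the complement read inside the ambient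
region), `regular := True` (A = 0 is regular), `bigBlocks := True` (not needed at `A = 0`).
[cite: Balaban1982Higgs1, Prop. 2.2 (2.27)–(2.29) p.611] -/
def zeroDelta {amin aplus : ℝ} (i : ZFNested d amin aplus) : B1.DeltaSetting where
  KSite := ↥i.Ω
  e := i.e
  regular := True
  bigBlocks := True
  udist := fun y y' => supNorm (y.1 - y'.1)
  distOc := fun y => dSet (i.Ω₀ \ i.Ω) y.1
  kerD := fun y y' => |KeffR i.n i.a i.m2 i.Ω y y'|
  kerDD0 := fun y y' => |KeffR i.n i.a i.m2 i.Ω y y' - KeffR i.n i.a i.m2 i.Ω₀ (incl i.hsub y) (incl i.hsub y')|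

/-- the (5.4)-constant of `KeffR_entry_decay` is bounded on the window: for `a₋ ≤ a ≤ a₊`, `0 < a₋`, `κ ≤ 1`,
`a + a²(2/min(2,a))e^κ ≤ a₊ + a₊²(2/min(2,a₋))e`. [folklore] -/
private theorem const54_le {amin aplus a κ : ℝ} (hamin : 0 < amin) (h1 : amin ≤ a) (h2 : a ≤ aplus) (hκ : κ ≤ 1) :
    a + a ^ 2 * (2 / min 2 a) * Real.exp κ ≤ aplus + aplus ^ 2 * (2 / min 2 amin) * Real.exp 1 := by
  have ha : 0 < a := hamin.trans_le h1
  have hσ : 0 < min 2 amin := lt_min (by norm_num) hamin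
  have hσa : 0 < min 2 a := lt_min (by norm_num) ha
  have hdiv : 2 / min 2 a ≤ 2 / min 2 amin := div_le_div_of_nonneg_left (by norm_num) hσ (min_le_min le_rfl h1)
  have hsq : a ^ 2 ≤ aplus ^ 2 := pow_le_pow_left₀ ha.le h2 2
  have hexp : Real.exp κ ≤ Real.exp 1 := Real.exp_le_exp.2 hκ
  have : a ^ 2 * (2 / min 2 a) * Real.exp κ ≤ aplus ^ 2 * (2 / min 2 amin) * Real.exp 1 :=
    mul_le_mul (mul_le_mul hsq hdiv (by positivity) (by positivity)) hexp (Real.exp_pos _).le (by positivity)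
  linarith

/-- **PROPOSITION 2.2 AT `A = 0`, LITERAL READING, NO HYPOTHESIS**: for every dimension `d + 1` and window
`0 < a₋ ≤ a_k ≤ a₊` there are `δ₀, c₀ > 0` (`δ₀ = ctRate(d,a₋,a₊)/4`) such that for EVERY mesh `η = 1/n`, every `a_k` of
the window, every `m² ≥ 0` and EVERY nested pair `Ω^{(k)} ⊆ Ω₀^{(k)}` of finite regions:
`|Δ^{(k)}(Ω,0)(y,y′)| ≤ c₀e^{−δ₀|y−y′|_∞}` ((2.27)) and `|Δ^{(k)}(Ω,0)(y,y′) − Δ^{(k)}(Ω₀,0)(y,y′)| ≤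
c₀e^{−δ₀(|y−y′|_∞ + dist(y,Ω₀^{(k)}∖Ω^{(k)}) + dist(y′,Ω₀^{(k)}∖Ω^{(k)}))}` ((2.29)) — the typed `B1.Prop22Literal` on the
zero-field family ((2.27) ⇐ the B4 cell's (5.4) `KeffR_entry_decay`, (2.29) ⇐ its (5.5) `keff55_region`).
[cite: Balaban1982Higgs1, Prop. 2.2 (2.27)–(2.29) p.611] -/
theorem prop22Literal_zeroField {amin aplus : ℝ} (hamin : 0 < amin) :
    B1.Prop22Literal (fun i : ZFNested d amin aplus => zeroDelta i) := by
  obtain ⟨δ, c, hδ, hc, hδeq, h55⟩ := keff55_region d amin aplus hamin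
  set C₁ : ℝ := aplus + aplus ^ 2 * (2 / min 2 amin) * Real.exp 1 with hC₁
  have hσ : 0 < min 2 amin := lt_min (by norm_num) hamin
  have hC₁abs : C₁ ≤ |C₁| + c := (le_abs_self C₁).trans (by linarith)
  refine ⟨δ, |C₁| + c, hδ, by positivity, fun i _ _ => ⟨fun y y' => ?_, fun y y' => ?_⟩⟩
  · -- (2.27) from (5.4)
    have ha : 0 < i.a := hamin.trans_le i.ha₁
    have hκ0 : 0 ≤ ctRate d amin aplus := (ctRate_pos d aplus hamin).le
    have hκ1 : ctRate d amin aplus ≤ 1 := ctRate_le_one d amin aplus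
    have h54 := KeffR_entry_decay i.hn ha i.hm hκ0 hκ1 (ctRate_small d hamin i.ha₁ i.ha₂) i.Ω y y'
    have hs : 0 ≤ supNorm (y.1 - y'.1) := supNorm_nonneg _
    have hrate : Real.exp (-(ctRate d amin aplus * supNorm (y.1 - y'.1))) ≤ Real.exp (-(δ * supNorm (y.1 - y'.1))) := by
      rw [Real.exp_le_exp, hδeq]; nlinarith
    have hC : i.a + i.a ^ 2 * (2 / min 2 i.a) * Real.exp (ctRate d amin aplus) ≤ C₁ := const54_le hamin i.ha₁ i.ha₂ hκ1
    have hC0 : 0 ≤ i.a + i.a ^ 2 * (2 / min 2 i.a) * Real.exp (ctRate d amin aplus) := by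
      have : 0 < min 2 i.a := lt_min (by norm_num) ha
      positivity
    show |KeffR i.n i.a i.m2 i.Ω y y'| ≤ (|C₁| + c) * Real.exp (-(δ * supNorm (y.1 - y'.1)))
    calc |KeffR i.n i.a i.m2 i.Ω y y'|
        ≤ (i.a + i.a ^ 2 * (2 / min 2 i.a) * Real.exp (ctRate d amin aplus))
            * Real.exp (-(ctRate d amin aplus * supNorm (y.1 - y'.1))) := h54
      _ ≤ C₁ * Real.exp (-(δ * supNorm (y.1 - y'.1))) := mul_le_mul hC hrate (Real.exp_pos _).le (hC0.trans hC)
      _ ≤ (|C₁| + c) * Real.exp (-(δ * supNorm (y.1 - y'.1))) :=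
          mul_le_mul_of_nonneg_right hC₁abs (Real.exp_pos _).le
  · -- (2.29) = (5.5)
    have h := h55 i.n i.hn i.a i.m2 i.ha₁ i.ha₂ i.hm i.Ω i.Ω₀ i.hsub y y'
    show |KeffR i.n i.a i.m2 i.Ω y y' - KeffR i.n i.a i.m2 i.Ω₀ (incl i.hsub y) (incl i.hsub y')|
      ≤ (|C₁| + c) * Real.exp (-(δ * (supNorm (y.1 - y'.1) + dSet (i.Ω₀ \ i.Ω) y.1 + dSet (i.Ω₀ \ i.Ω) y'.1)))
    exact h.trans (mul_le_mul_of_nonneg_right (by linarith [abs_nonneg C₁]) (Real.exp_pos _).le)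

/-- the intended reading (with the inherited threshold) follows. [cite: Balaban1982Higgs1, Prop. 2.2 p.611] -/
theorem prop22Small_zeroField {amin aplus : ℝ} (hamin : 0 < amin) :
    B1.Prop22Small (fun i : ZFNested d amin aplus => zeroDelta i) :=
  B1.prop22Small_of_literal _ (prop22Literal_zeroField hamin)

/-! ## §2. The printed derivation (B4 p. 593–594): Cor. 2.3 ⟹ Prop. 2.2, for every dictionary instance -/

/-- ONE DICTIONARY INSTANCE for *"Corollary 2.3 implies … (5.4) … (5.5)"*: a Prop-I.2.1/B4 instance `S` (b04's
carrier, whose fields NAME the pairings `|⟨f, G_k(Ω,A)f′⟩|`, `|⟨f, δG_kf′⟩|`, `‖f‖₂`, `dist(supp f, supp f′)`,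
`dist(supp f, Ωᶜ)`); the unit sites `y ∈ Ω^{(k)}` (`KSite`); nonempty test vectors `v` and the sources `f_{y,v} =
Q_k^*(A)(vδ_y)` (‖·‖₂ ∈ [0,1]); a direction `μ₀` (the pairing field takes two, unused at index `0`); the coefficients
`a₁ = a_k`, `a₂ = a_k²` in `[0, aM]`; the printed distances `|y − y′|` (`udist`), `dist(y, Ω^{(k)c})` (`distOc`) and the
diagonal indicator `ind` (`≤ 1`, `≤ 0` off the diagonal); the two kernels of Prop. 2.2 with their DOMINATIONS by the
dictionary — `|Δ^{(k)}(y,y′)| ≤ a₁·ind(y,y′) + a₂·sup_{v,v′}|⟨f_{y,v}, Gf_{y′,v′}⟩|` ((1.14)), `|δΔ^{(k)}(y,y′)| ≤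
a₂·sup|⟨f_{y,v}, δGf_{y′,v′}⟩|` (the diagonal cancels) — and the geometry with one allowance `D`:
`|y − y′| ≤ dist(supp f_y, supp f_{y′}) + D`, `dist(y,Ω^{(k)c}) ≤ dist(supp f_y, Ωᶜ) + D`.
[cite: Balaban1983RegularityDecay, p.593–594 (5.4)–(5.5)] -/
structure DictΔ (D aM : ℝ) where
  /-- the instance `(k, Ω ⊂ Ω₀, A, e)` -/
  S : B4.EtaSetting
  /-- the unit sites `y ∈ Ω^{(k)}` -/
  KSite : Type
  /-- test vectors -/
  V : Type
  hV : Nonempty V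
  /-- `f_{y,v} = Q_k^*(A)(vδ_y)` -/
  src : KSite → V → S.Src
  /-- a direction (inert at pairing index `0`) -/
  μ0 : S.Dir
  /-- `a_k`, `a_k²` -/
  a₁ : ℝ
  a₂ : ℝ
  ha₁ : 0 ≤ a₁
  ha₁M : a₁ ≤ aM
  ha₂ : 0 ≤ a₂
  ha₂M : a₂ ≤ aM
  /-- `|y − y′|` -/
  udist : KSite → KSite → ℝ
  /-- `dist(y, Ω^{(k)c})` -/
  distOc : KSite → ℝ
  /-- `1_{y = y′}` -/
  ind : KSite → KSite → ℝ
  /-- `|Δ^{(k)}(Ω,A;y,y′)|` -/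
  kerD : KSite → KSite → ℝ
  /-- `|δΔ^{(k)}(Ω,Ω₀,A;y,y′)|` -/
  kerDD0 : KSite → KSite → ℝ
  ind_le_one : ∀ y y', ind y y' ≤ 1
  ind_off : ∀ y y', 0 < udist y y' → ind y y' ≤ 0
  l2_nonneg : ∀ y v, 0 ≤ S.l2Norm (src y v)
  l2_le_one : ∀ y v, S.l2Norm (src y v) ≤ 1
  kerD_le : ∀ y y', kerD y y' ≤ a₁ * ind y y' + a₂ * ⨆ p : V × V, S.pair 0 μ0 μ0 (src y p.1) (src y' p.2)
  kerDD0_le : ∀ y y', kerDD0 y y' ≤ a₂ * ⨆ p : V × V, S.dpair 0 μ0 μ0 (src y p.1) (src y' p.2)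
  udist_le : ∀ y y' v v', udist y y' ≤ S.ssdist (src y v) (src y' v') + D
  distOc_le : ∀ y v, distOc y ≤ S.bdistS (src y v) + D

/-- the `B1.DeltaSetting` LINKED to a dictionary instance (same `e`, `regular`, `bigBlocks`, the printed distances and
kernels). [cite: Balaban1982Higgs1, Prop. 2.2 (2.27)–(2.29) p.611] -/
def DictΔ.toDelta {D aM : ℝ} (𝔇 : DictΔ D aM) : B1.DeltaSetting where
  KSite := 𝔇.KSite
  e := 𝔇.S.e
  regular := 𝔇.S.regular
  bigBlocks := 𝔇.S.bigBlocks
  udist := 𝔇.udist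
  distOc := 𝔇.distOc
  kerD := 𝔇.kerD
  kerDD0 := 𝔇.kerDD0

/-- the diagonal term: `a₁·1_{y=y′} ≤ a₁e^{−δ|y−y′|}` (`ind ≤ 1`, and `≤ 0` wherever the distance is positive). [folklore] -/
private theorem diag_le {a₁ ind u δ : ℝ} (ha : 0 ≤ a₁) (hδ : 0 ≤ δ) (h1 : ind ≤ 1) (h0 : 0 < u → ind ≤ 0) :
    a₁ * ind ≤ a₁ * Real.exp (-(δ * u)) := by
  refine mul_le_mul_of_nonneg_left ?_ ha
  by_cases hu : 0 < u
  · exact (h0 hu).trans (Real.exp_pos _).le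
  · have : 1 ≤ Real.exp (-(δ * u)) := by
      rw [← Real.exp_zero, Real.exp_le_exp]; nlinarith
    exact h1.trans this

/-- **PROPOSITION 2.2 ⇐ COROLLARY 2.3** (B4 p. 593–594: *"Finally Corollary 2.3 implies that the considered operator is
short-ranged … (5.4) … and a change of the domain Ω implies a change of the operator … (5.5)"*): for every family of
dictionary instances with allowance `D ≥ 0` and coefficient bound `aM > 0`, b04's typed `B4.Cor23Printed` for the
underlying B4 instances implies the cell's `B1.Prop22Small` (Prop. 2.2 in the intended reading, threshold inherited) for
the linked family, with the same `δ₀`, `e₁` and `c₀ ↦ aM + aM·c₀·e^{3δ₀D}`.  Mechanism: `|Δ(y,y′)| ≤ a₁1_{y=y′} +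
a₂|⟨f_y, Gf_{y′}⟩| ≤ a₁e^{−δ₀|y−y′|} + a₂c₀e^{−δ₀(|y−y′|−D)}‖f_y‖₂‖f_{y′}‖₂`; for δΔ the factor
`e^{−δ₀(dist(supp f_y,Ωᶜ)+dist(supp f_{y′},Ωᶜ))} ≤ e^{2δ₀D}e^{−δ₀(dist(y,Ω^{(k)c})+dist(y′,Ω^{(k)c}))}`.
[cite: Balaban1982Higgs1, Prop. 2.2 (2.27)–(2.29) p.611] -/
theorem prop22Small_of_cor23Printed {I : Type} {D aM : ℝ} (hD : 0 ≤ D) (haM : 0 < aM) (𝔇 : I → DictΔ D aM)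
    (h : B4.Cor23Printed (fun i => (𝔇 i).S)) : B1.Prop22Small (fun i => (𝔇 i).toDelta) := by
  obtain ⟨c₀, δ₀, e₁, hc, hδ, he, h⟩ := h
  refine ⟨δ₀, aM + aM * c₀ * Real.exp (3 * δ₀ * D), e₁, hδ, by positivity, he, fun i hreg hbig he0 he1 => ?_⟩
  have hcl := h i hreg hbig he0 he1
  haveI := (𝔇 i).hV
  have hE1 : (1 : ℝ) ≤ Real.exp (3 * δ₀ * D) := by
    rw [← Real.exp_zero, Real.exp_le_exp]; positivity
  dsimp only [DictΔ.toDelta]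
  refine ⟨fun y y' => ?_, fun y y' => ?_⟩
  · -- (2.27)
    have hsup : (⨆ p : (𝔇 i).V × (𝔇 i).V, (𝔇 i).S.pair 0 (𝔇 i).μ0 (𝔇 i).μ0 ((𝔇 i).src y p.1) ((𝔇 i).src y' p.2))
        ≤ c₀ * Real.exp (δ₀ * D) * Real.exp (-(δ₀ * (𝔇 i).udist y y')) := by
      refine ciSup_le fun p => ?_
      have hp := (hcl 0 (𝔇 i).μ0 (𝔇 i).μ0 ((𝔇 i).src y p.1) ((𝔇 i).src y' p.2)).1
      have hN : (𝔇 i).S.l2Norm ((𝔇 i).src y p.1) * (𝔇 i).S.l2Norm ((𝔇 i).src y' p.2) ≤ 1 := by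
        calc _ ≤ 1 * 1 := mul_le_mul ((𝔇 i).l2_le_one y p.1) ((𝔇 i).l2_le_one y' p.2)
              ((𝔇 i).l2_nonneg y' p.2) zero_le_one
          _ = 1 := one_mul 1
      have hsh : Real.exp (-(δ₀ * (𝔇 i).S.ssdist ((𝔇 i).src y p.1) ((𝔇 i).src y' p.2)))
          ≤ Real.exp (δ₀ * D) * Real.exp (-(δ₀ * (𝔇 i).udist y y')) := by
        rw [← Real.exp_add, Real.exp_le_exp]
        have := mul_le_mul_of_nonneg_left ((𝔇 i).udist_le y y' p.1 p.2) hδ.le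
        rw [mul_add] at this
        linarith
      calc _ ≤ c₀ * Real.exp (-(δ₀ * (𝔇 i).S.ssdist ((𝔇 i).src y p.1) ((𝔇 i).src y' p.2)))
            * ((𝔇 i).S.l2Norm ((𝔇 i).src y p.1) * (𝔇 i).S.l2Norm ((𝔇 i).src y' p.2)) := by
              rw [← mul_assoc]; exact hp
        _ ≤ c₀ * Real.exp (-(δ₀ * (𝔇 i).S.ssdist ((𝔇 i).src y p.1) ((𝔇 i).src y' p.2))) :=
              mul_le_of_le_one_right (by positivity) hN
        _ ≤ c₀ * (Real.exp (δ₀ * D) * Real.exp (-(δ₀ * (𝔇 i).udist y y'))) :=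
              mul_le_mul_of_nonneg_left hsh hc.le
        _ = _ := by ring
    have hdiag := diag_le (u := (𝔇 i).udist y y') (𝔇 i).ha₁ hδ.le ((𝔇 i).ind_le_one y y') ((𝔇 i).ind_off y y')
    have hE3 : Real.exp (δ₀ * D) ≤ Real.exp (3 * δ₀ * D) := Real.exp_le_exp.2 (by nlinarith)
    calc (𝔇 i).kerD y y'
        ≤ (𝔇 i).a₁ * (𝔇 i).ind y y' + (𝔇 i).a₂ * ⨆ p : (𝔇 i).V × (𝔇 i).V,
            (𝔇 i).S.pair 0 (𝔇 i).μ0 (𝔇 i).μ0 ((𝔇 i).src y p.1) ((𝔇 i).src y' p.2) := (𝔇 i).kerD_le y y'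
      _ ≤ (𝔇 i).a₁ * Real.exp (-(δ₀ * (𝔇 i).udist y y'))
          + (𝔇 i).a₂ * (c₀ * Real.exp (δ₀ * D) * Real.exp (-(δ₀ * (𝔇 i).udist y y'))) :=
            add_le_add hdiag (mul_le_mul_of_nonneg_left hsup (𝔇 i).ha₂)
      _ ≤ aM * Real.exp (-(δ₀ * (𝔇 i).udist y y'))
          + aM * (c₀ * Real.exp (3 * δ₀ * D) * Real.exp (-(δ₀ * (𝔇 i).udist y y'))) :=
            add_le_add (mul_le_mul_of_nonneg_right (𝔇 i).ha₁M (Real.exp_pos _).le)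
              (mul_le_mul (𝔇 i).ha₂M
                (mul_le_mul_of_nonneg_right (mul_le_mul_of_nonneg_left hE3 hc.le) (Real.exp_pos _).le)
                (by positivity) haM.le)
      _ = (aM + aM * c₀ * Real.exp (3 * δ₀ * D)) * Real.exp (-(δ₀ * (𝔇 i).udist y y')) := by ring
  · -- (2.29)
    have hsup : (⨆ p : (𝔇 i).V × (𝔇 i).V, (𝔇 i).S.dpair 0 (𝔇 i).μ0 (𝔇 i).μ0 ((𝔇 i).src y p.1) ((𝔇 i).src y' p.2))
        ≤ c₀ * Real.exp (3 * δ₀ * D) *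
          Real.exp (-(δ₀ * ((𝔇 i).udist y y' + (𝔇 i).distOc y + (𝔇 i).distOc y'))) := by
      refine ciSup_le fun p => ?_
      have hp := (hcl 0 (𝔇 i).μ0 (𝔇 i).μ0 ((𝔇 i).src y p.1) ((𝔇 i).src y' p.2)).2
      have hN : (𝔇 i).S.l2Norm ((𝔇 i).src y p.1) * (𝔇 i).S.l2Norm ((𝔇 i).src y' p.2) ≤ 1 := by
        calc _ ≤ 1 * 1 := mul_le_mul ((𝔇 i).l2_le_one y p.1) ((𝔇 i).l2_le_one y' p.2)
              ((𝔇 i).l2_nonneg y' p.2) zero_le_one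
          _ = 1 := one_mul 1
      have hsh : Real.exp (-(δ₀ * (𝔇 i).S.ssdist ((𝔇 i).src y p.1) ((𝔇 i).src y' p.2)))
          * Real.exp (-(δ₀ * ((𝔇 i).S.bdistS ((𝔇 i).src y p.1) + (𝔇 i).S.bdistS ((𝔇 i).src y' p.2))))
          ≤ Real.exp (3 * δ₀ * D) *
            Real.exp (-(δ₀ * ((𝔇 i).udist y y' + (𝔇 i).distOc y + (𝔇 i).distOc y'))) := by
        rw [← Real.exp_add, ← Real.exp_add, Real.exp_le_exp]
        have e1 := mul_le_mul_of_nonneg_left ((𝔇 i).udist_le y y' p.1 p.2) hδ.le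
        have e2 := mul_le_mul_of_nonneg_left ((𝔇 i).distOc_le y p.1) hδ.le
        have e3 := mul_le_mul_of_nonneg_left ((𝔇 i).distOc_le y' p.2) hδ.le
        rw [mul_add] at e1 e2 e3
        nlinarith
      calc _ ≤ c₀ * (Real.exp (-(δ₀ * (𝔇 i).S.ssdist ((𝔇 i).src y p.1) ((𝔇 i).src y' p.2)))
            * Real.exp (-(δ₀ * ((𝔇 i).S.bdistS ((𝔇 i).src y p.1) + (𝔇 i).S.bdistS ((𝔇 i).src y' p.2)))))
            * ((𝔇 i).S.l2Norm ((𝔇 i).src y p.1) * (𝔇 i).S.l2Norm ((𝔇 i).src y' p.2)) := by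
              have := hp
              calc _ ≤ _ := this
                _ = _ := by ring
        _ ≤ c₀ * (Real.exp (-(δ₀ * (𝔇 i).S.ssdist ((𝔇 i).src y p.1) ((𝔇 i).src y' p.2)))
            * Real.exp (-(δ₀ * ((𝔇 i).S.bdistS ((𝔇 i).src y p.1) + (𝔇 i).S.bdistS ((𝔇 i).src y' p.2))))) :=
              mul_le_of_le_one_right (by positivity) hN
        _ ≤ c₀ * (Real.exp (3 * δ₀ * D) *
            Real.exp (-(δ₀ * ((𝔇 i).udist y y' + (𝔇 i).distOc y + (𝔇 i).distOc y')))) :=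
              mul_le_mul_of_nonneg_left hsh hc.le
        _ = _ := by ring
    have h0 : 0 ≤ aM * Real.exp (-(δ₀ * ((𝔇 i).udist y y' + (𝔇 i).distOc y + (𝔇 i).distOc y'))) := by
      positivity
    calc (𝔇 i).kerDD0 y y'
        ≤ (𝔇 i).a₂ * ⨆ p : (𝔇 i).V × (𝔇 i).V,
            (𝔇 i).S.dpair 0 (𝔇 i).μ0 (𝔇 i).μ0 ((𝔇 i).src y p.1) ((𝔇 i).src y' p.2) := (𝔇 i).kerDD0_le y y'
      _ ≤ (𝔇 i).a₂ * (c₀ * Real.exp (3 * δ₀ * D) *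
          Real.exp (-(δ₀ * ((𝔇 i).udist y y' + (𝔇 i).distOc y + (𝔇 i).distOc y')))) :=
            mul_le_mul_of_nonneg_left hsup (𝔇 i).ha₂
      _ ≤ aM * (c₀ * Real.exp (3 * δ₀ * D) *
          Real.exp (-(δ₀ * ((𝔇 i).udist y y' + (𝔇 i).distOc y + (𝔇 i).distOc y')))) :=
            mul_le_mul_of_nonneg_right (𝔇 i).ha₂M (by positivity)
      _ = aM * c₀ * Real.exp (3 * δ₀ * D) *
          Real.exp (-(δ₀ * ((𝔇 i).udist y y' + (𝔇 i).distOc y + (𝔇 i).distOc y'))) := by ring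
      _ ≤ (aM + aM * c₀ * Real.exp (3 * δ₀ * D)) *
          Real.exp (-(δ₀ * ((𝔇 i).udist y y' + (𝔇 i).distOc y + (𝔇 i).distOc y'))) := by
            rw [add_mul]; linarith [h0]

end

end Literature.MathematicalPhysics.QuantumFieldTheory.Balaban1983to89.B1Prop22Proof
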